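import Literature.AlgebraicGeometry.HodgeTheory.LefschetzDecompositionPolarizationForm
import Literature.AlgebraicGeometry.HodgeTheory.UniversalHypersurfaceFlatCoefficient
import HarnessLib

/-!
# The polarization form of the Lefschetz decomposition under scaling of the Kähler class:
# `Q_{μκ,τ} = μ^{n-k} Q_{κ,τ}` on `Hᵏ` (so on the middle cohomology it does not depend on the scaling)

Family `hodge`, layer `Literature/AlgebraicGeometry/HodgeTheory`; proof file (theorems only, no
definition, no named fact). Written by the prover seat `hodge-nonav-prover-Ax` (g11, cell `hodge-nonav`)
for the programme «GRIFFITHS-SURFACES» (brick B5b-geometric: Kähler–rational data of two fibres of a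
family pull back classes of `H²(ℙᴺ)` which differ by a scalar; the polarization forms of the MIDDLE
cohomology are then literally comparable).

For a unit `μ` of the coefficient ring and a class `κ ∈ H²(Y; R)` with the hard Lefschetz property
in dimension `n`:

* `lefschetzOperator_smul_class`, `lefschetzPow_smul_class` — `L_{μκ} = μ L_κ`, `Lʲ_{μκ} = μʲ Lʲ_κ` (the `lefschetzPowTo`
  form is the tree's `lefschetzPowTo_smul_class` of `UniversalHypersurfaceFlatCoefficient`);
* `hasHardLefschetzProperty_smul_class` — `μκ` has the hard Lefschetz property;
* `mem_primitiveClasses_smul_class_iff` — primitive classes for `μκ` and for `κ` coincide;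
* `primitivePart_smul_class` — `ξ^{μκ}_{(a,t)} x = μ^{-t} ξ^κ_{(a,t)} x` (uniqueness of the Lefschetz
  decomposition);
* **`polarizationForm_smul_class`** — `Q_{μκ,τ}(x, y) = μ^{n-k} Q_{κ,τ}(x, y)` on `Hᵏ`, `k ≤ n` (each
  Hodge–Riemann pairing of index `(a,t)`, `a + 2t = k`, picks up `μ^{(n-a) - 2t} = μ^{n-k}`); in
  particular `Q_{μκ,τ} = Q_{κ,τ}` on the middle cohomology `Hⁿ` (`polarizationForm_smul_class_middle`).

## References

* [VoisinHodgeI2002] C. Voisin, Hodge Theory and Complex Algebraic Geometry I, CUP 2002, §6.2.3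
  Cor. 6.26, §6.3.2, §7.1.2.
-/

noncomputable section

open CategoryTheory AlgebraicGeometry

universe u

namespace Literature.AlgebraicGeometry.HodgeTheory

section HodgeTheory

open Literature.AlgebraicTopology.SingularHomology Literature.Geometry.Kaehler

section ScaleClass

-- `R : Type` (universe `0`, as in `UniversalHypersurfaceFlatCoefficient.lefschetzPowTo_smul_class`, which
-- is reused here; the application is `R = ℂ`).
variable {Y : Type u} [TopologicalSpace Y] {R : Type} [CommRing R]
  (κ : singularCohomology R R Y 2) {n : ℕ}

/-- `L_{cκ} = c L_κ`. [cite: VoisinHodgeI2002, §6.2.3] -/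
theorem lefschetzOperator_smul_class (c : R) {k l : ℕ} (h : 2 + k = l) (x : singularCohomology R R Y k) :
    lefschetzOperator (c • κ) h x = c • lefschetzOperator κ h x := by
  rw [lefschetzOperator_apply, lefschetzOperator_apply, LinearMap.map_smul, LinearMap.smul_apply]

/-- `Lʲ_{cκ} = cʲ Lʲ_κ` for the tree's `lefschetzPow`. [cite: VoisinHodgeI2002, §6.2.3] -/
theorem lefschetzPow_smul_class (c : R) (j k : ℕ) (x : singularCohomology R R Y k) :
    lefschetzPow (c • κ) j k x = c ^ j • lefschetzPow κ j k x := by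
  change lefschetzPowTo (c • κ) j k (k + 2 * j) rfl x = c ^ j • lefschetzPowTo κ j k (k + 2 * j) rfl x
  exact lefschetzPowTo_smul_class κ c j k (k + 2 * j) rfl x

/-- **Scaling by a unit preserves the hard Lefschetz property.** [cite: VoisinHodgeI2002, §6.2.3 Thm. 6.25] -/
theorem hasHardLefschetzProperty_smul_class (μ : Rˣ) (hL : HasHardLefschetzProperty κ n) :
    HasHardLefschetzProperty ((μ : R) • κ) n := by
  intro j k hk
  obtain ⟨hinj, hsurj⟩ := hL j k hk
  constructor
  · intro x y hxy
    rw [lefschetzPow_smul_class, lefschetzPow_smul_class, ← Units.val_pow_eq_pow_val, ← Units.smul_def,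
      ← Units.smul_def] at hxy
    have h := congrArg (fun w ↦ (μ ^ j)⁻¹ • w) hxy
    simp only [inv_smul_smul] at h
    exact hinj h
  · intro z
    obtain ⟨x, hx⟩ := hsurj ((μ ^ j)⁻¹ • z)
    refine ⟨x, ?_⟩
    rw [lefschetzPow_smul_class, hx, ← Units.val_pow_eq_pow_val, ← Units.smul_def, smul_inv_smul]

/-- Primitive classes for `μκ` and for `κ` coincide (`μ` a unit). [cite: VoisinHodgeI2002, §6.2.3 Def. 6.24] -/
theorem mem_primitiveClasses_smul_class_iff (μ : Rˣ) {a : ℕ} (x : singularCohomology R R Y a) :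
    x ∈ primitiveClasses ((μ : R) • κ) n a ↔ x ∈ primitiveClasses κ n a := by
  constructor
  · intro hx
    refine ⟨hx.1, fun r m h hr ↦ ?_⟩
    have h0 := hx.2 r m h hr
    rw [lefschetzPowTo_smul_class, ← Units.val_pow_eq_pow_val, ← Units.smul_def] at h0
    exact (smul_eq_zero_iff_eq (μ ^ r)).1 h0
  · intro hx
    refine ⟨hx.1, fun r m h hr ↦ ?_⟩
    rw [lefschetzPowTo_smul_class, hx.2 r m h hr, smul_zero]

variable (hL : HasHardLefschetzProperty κ n)
  (hvan : ∀ m, 2 * n < m → Subsingleton (singularCohomology R R Y m)) (μ : Rˣ)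

/-- **The primitive parts scale by `μ^{-t}`**: `ξ^{μκ}_{(a,t)} x = (μ⁻¹)ᵗ ξ^κ_{(a,t)} x` (uniqueness of
the Lefschetz decomposition: `x = ∑ Lᵗ_{μκ}((μ⁻¹)ᵗ ξ_{(a,t)} x)`). [cite: VoisinHodgeI2002, §6.2.3 Cor. 6.26] -/
theorem primitivePart_smul_class {i : ℕ} (p : {p : ℕ × ℕ // p.1 + 2 * p.2 = i})
    (x : singularCohomology R R Y i) :
    primitivePart ((μ : R) • κ) n (hasHardLefschetzProperty_smul_class κ μ hL) hvan p x =
      ((μ⁻¹ ^ p.1.2 : Rˣ) : R) • primitivePart κ n hL hvan p x := by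
  refine primitivePart_eq_of_sum_eq (hasHardLefschetzProperty_smul_class κ μ hL) hvan
    (y := fun q ↦ ((μ⁻¹ ^ q.1.2 : Rˣ) : R) • primitivePart κ n hL hvan q x)
    (fun q ↦ Submodule.smul_mem _ _ ((mem_primitiveClasses_smul_class_iff κ μ _).2
      (primitivePart_mem hL hvan q x)))
    (fun q hq ↦ by
      rw [primitivePart_of_lt hL hvan q hq, LinearMap.zero_apply, smul_zero]) ?_ p
  conv_rhs => rw [← sum_lefschetzPowTo_primitivePart hL hvan x]
  refine Finset.sum_congr rfl fun q _ ↦ ?_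
  rw [lefschetzPowTo_smul_class, LinearMap.map_smul, smul_smul, ← Units.val_pow_eq_pow_val,
    ← Units.val_mul, ← mul_pow, mul_inv_cancel, one_pow, Units.val_one, one_smul]

/-- **`Q_{μκ,τ} = μ^{n-k} Q_{κ,τ}` on `Hᵏ(Y; R)` for `k ≤ n`.** Each Hodge–Riemann pairing of index
`(a,t)`, `a + 2t = k`, `a + s = n`, reads `(-1)^{a(a-1)/2} τ(Lˢ_{μκ} ξ^{μκ} ∪ ξ'^{μκ}) =
μ^{s} μ^{-t} μ^{-t} (-1)^{a(a-1)/2} τ(Lˢ_κ ξ ∪ ξ')`, and `s - 2t = n - k`.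
[cite: VoisinHodgeI2002, §6.3.2 and §7.1.2] -/
theorem polarizationForm_smul_class (τ : singularCohomology R R Y (2 * n) →ₗ[R] R) {k : ℕ} (hk : k ≤ n)
    (x y : singularCohomology R R Y k) :
    polarizationForm ((μ : R) • κ) n (hasHardLefschetzProperty_smul_class κ μ hL) hvan τ k x y =
      (μ : R) ^ (n - k) * polarizationForm κ n hL hvan τ k x y := by
  rw [polarizationForm_apply, polarizationForm_apply, Finset.mul_sum]
  refine Finset.sum_congr rfl fun p _ ↦ ?_
  rw [primitivePart_smul_class κ hL hvan μ p x, primitivePart_smul_class κ hL hvan μ p y]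
  generalize primitivePart κ n hL hvan p x = ξ
  generalize primitivePart κ n hL hvan p y = ξ'
  rcases le_or_gt p.1.1 n with ha | ha
  · obtain ⟨s, hs⟩ : ∃ s, p.1.1 + s = n := ⟨n - p.1.1, by omega⟩
    have hm : p.1.1 + 2 * s = 2 * n - p.1.1 := by omega
    have h : (2 * n - p.1.1) + p.1.1 = 2 * n := by omega
    rw [hodgeRiemannPairing_apply τ hs hm h, hodgeRiemannPairing_apply τ hs hm h]
    simp only [lefschetzPowTo_smul_class, LinearMap.map_smul, LinearMap.smul_apply, smul_eq_mul]
    -- the scalar: `μ^s (μ⁻¹)^t (μ⁻¹)^t = μ^{n-k}` with `s = (n - k) + 2t`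
    have hst : s = (n - k) + 2 * p.1.2 := by
      have := p.2
      omega
    have hscal : (μ : R) ^ s * (((μ⁻¹ ^ p.1.2 : Rˣ) : R) * ((μ⁻¹ ^ p.1.2 : Rˣ) : R)) =
        (μ : R) ^ (n - k) := by
      rw [hst, pow_add, mul_assoc]
      conv_rhs => rw [← mul_one ((μ : R) ^ (n - k))]
      congr 1
      rw [← Units.val_pow_eq_pow_val, ← Units.val_mul, ← pow_add, ← two_mul, ← Units.val_mul, ← mul_pow,
        mul_inv_cancel, one_pow, Units.val_one]
    rw [show (μ : R) ^ (n - k) = (μ : R) ^ s * (((μ⁻¹ ^ p.1.2 : Rˣ) : R) * ((μ⁻¹ ^ p.1.2 : Rˣ) : R))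
      from hscal.symm]
    ring
  · simp only [hodgeRiemannPairing_of_lt τ ha, LinearMap.zero_apply, mul_zero]

/-- **On the middle cohomology the polarization form does not depend on the scaling of the class**:
`Q_{μκ,τ} = Q_{κ,τ}` on `Hⁿ(Y; R)`. [cite: VoisinHodgeI2002, §7.1.2] -/
theorem polarizationForm_smul_class_middle (τ : singularCohomology R R Y (2 * n) →ₗ[R] R)
    (x y : singularCohomology R R Y n) :
    polarizationForm ((μ : R) • κ) n (hasHardLefschetzProperty_smul_class κ μ hL) hvan τ n x y =
      polarizationForm κ n hL hvan τ n x y := by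
  rw [polarizationForm_smul_class κ hL hvan μ τ le_rfl, Nat.sub_self, pow_zero, one_mul]

end ScaleClass

end HodgeTheory

end Literature.AlgebraicGeometry.HodgeTheory

end
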